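import Literature.NumberTheory.EllipticCurves.Greenberg1999.SelmerCorankLayerBound
import Literature.NumberTheory.EllipticCurves.CyclotomicZpExtensionLayerOneSqrtTwoProofs
import Literature.NumberTheory.EllipticCurves.SelmerInftyTorsionFiniteProofs
import HarnessLib

/-!
# Greenberg (LNM 1716, 1999), Theorem 1.9 at the layer `ℚ_1 = ℚ(√2)` of the cyclotomic
# `ℤ_2`-extension — PROOFS ONLY: `s₂(E/ℚ) + s₂(E^{(2)}/ℚ) ≤ λ(X₂(E/ℚ_∞))` with every auxiliary
# hypothesis of the corollary in `SelmerCorankLayerBound.lean` discharged by tree theorems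

Topic `NumberTheory/EllipticCurves`, sub-story `Greenberg1999`; literature seat `bsd-rank2-lit`
(cell `bsd-rank2`, gen 15) for the cell's planner `p2` GEN 14 (door (F\*) at `p = 2`, fact pack
`PublishedInputsAtTwo`, conjunct (d)). No new definitions, no new named facts.

The sibling `SelmerCorankLayerBound.lean` vendors the Selmer-corank clause of Theorem 1.9 as the
named fact `thm19_selmerCorank_layer_le_lambdaInvariant` and proves from it
`selmerCorank_add_selmerCorank_quadraticTwist_two_le … [Module.Finite Λ D.X] … (hsqrt : ∃ θ : κ.layer 1, θ ^ 2 = 2)`.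
Both auxiliary inputs are tree theorems:
* `hsqrt` — `ZpExtension.IsCyclotomic.exists_sq_eq_two_layer_one` (file
  `CyclotomicZpExtensionLayerOneSqrtTwoProofs`: `ℚ_1 ⊆ ℚ(μ_8)` is the fixed field of
  `{u ≡ ±1 (8)}`, which fixes `ζ_8 + ζ_8⁻¹ = √2`; Washington §13.1);
* `Module.Finite Λ D.X` — `WeierstrassCurve.SelmerDualData.module_finite_of_isCyclotomic` (file
  `SelmerInftyTorsionFiniteProofs`: `X(E/ℚ_∞^{cyc})` is finitely generated over `Λ`, Greenberg p. 60).
So p2's conjunct (d) follows from the single printed fact `thm19_selmerCorank_layer_le_lambdaInvariant`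
(Greenberg Thm. 1.9, corank clause, `F = ℚ`), verbatim in p2's binders
(`selmerCorank_add_selmerCorank_quadraticTwist_two_le_of_isOrdinaryAt`).

References: R. Greenberg, *Iwasawa theory for elliptic curves*, LNM **1716** (1999), Thm. 1.9
(§1, PDF p. 63) [bib `GreenbergLNM1716`]; T. Dokchitser, V. Dokchitser, *On the
Birch–Swinnerton-Dyer quotients modulo squares*, Ann. of Math. **172** (2010), Lemma 4.14
[bib `DokchitserDokchitserAnnals2010`]; L. Washington, *Introduction to cyclotomic fields*, GTM 83,
§13.1 [bib `Washington1997`].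
-/

noncomputable section

open WeierstrassCurve Literature.NumberTheory.EllipticCurves

namespace Literature.NumberTheory.EllipticCurves.Greenberg1999

namespace thm19_selmerCorank_layer_le_lambdaInvariant

/-- **Theorem 1.9 at `ℚ_1 = ℚ(√2)`, all auxiliary inputs discharged.** For `E/ℚ` globally
minimal, elliptic, good ordinary or multiplicative at `2`, the cyclotomic `ℤ_2`-extension `κ` with
topological generator `γ`, and a `Λ`-torsion dual datum `D` of `Sel_{2^∞}(E/ℚ_∞)`:
`corank Sel_{2^∞}(E/ℚ) + corank Sel_{2^∞}(E^{(2)}/ℚ) ≤ λ(X(E/ℚ_∞)) = D.lambda`.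
Theorem 1.9 (corank clause, the hypothesis `h`) at the layer `n = 1`, the decomposition
`s₂(E/ℚ(√2)) = s₂(E/ℚ) + s₂(E^{(2)}/ℚ)` (Dokchitser–Dokchitser Lemma 4.14, tree theorem
`selmerCorank_baseChange_eq_add`), `√2 ∈ ℚ_1` (`ZpExtension.IsCyclotomic.exists_sq_eq_two_layer_one`)
and the finite generation of `X(E/ℚ_∞^{cyc})` (`SelmerDualData.module_finite_of_isCyclotomic`).
[cite: GreenbergLNM1716, Thm. 1.9 (§1, PDF p. 63)] [cite: DokchitserDokchitserAnnals2010, Lemma 4.14] [cite: Washington1997, §13.1] -/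
theorem selmerCorank_add_selmerCorank_quadraticTwist_two_le_lambda
    (h : thm19_selmerCorank_layer_le_lambdaInvariant)
    (W : WeierstrassCurve ℚ) [W.IsElliptic] [W.IsGloballyMinimal]
    (hred : IsOrdinaryAt W 2 ∨ W.HasMultiplicativeReductionAtPrime 2)
    {κ : ZpExtension ℚ 2} {γ : Field.absoluteGaloisGroup ℚ}
    (hκ : κ.IsCyclotomic) (hγ : κ.IsTopGenerator γ) (D : W.SelmerDualData κ γ)
    (hD : D.IsTorsion) :
    W.selmerCorank 2 + (W.quadraticTwist 2).selmerCorank 2 ≤ D.lambda := by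
  haveI : Module.Finite (IwasawaAlgebra 2) D.X :=
    SelmerDualData.module_finite_of_isCyclotomic (W := W) κ hκ D hγ
  exact selmerCorank_add_selmerCorank_quadraticTwist_two_le h W hred hκ hγ D hD
    hκ.exists_sq_eq_two_layer_one

/-- **Conjunct (d) of p2's `PublishedInputsAtTwo`, verbatim in its binders** (cell `bsd-rank2`,
door (F\*), sketch `TwoAdicLambdaTransport`): for every globally minimal elliptic `E/ℚ` good
ordinary at `2`, every cyclotomic `ℤ_2`-extension datum `(κ, γ)` and every `Λ`-torsion dual datum
`D`, `s₂(E/ℚ) + s₂(E^{(2)}/ℚ) ≤ D.lambda` — from Theorem 1.9 (corank clause) alone.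
[cite: GreenbergLNM1716, Thm. 1.9 (§1, PDF p. 63)] [cite: DokchitserDokchitserAnnals2010, Lemma 4.14] -/
theorem selmerCorank_add_selmerCorank_quadraticTwist_two_le_of_isOrdinaryAt
    (h : thm19_selmerCorank_layer_le_lambdaInvariant) :
    ∀ (W : WeierstrassCurve ℚ) [W.IsElliptic] [W.IsGloballyMinimal], IsOrdinaryAt W 2 →
      ∀ (κ : ZpExtension ℚ 2) (γ : Field.absoluteGaloisGroup ℚ),
        κ.IsCyclotomic → κ.IsTopGenerator γ →
          ∀ D : W.SelmerDualData κ γ, D.IsTorsion →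
            W.selmerCorank 2 + (W.quadraticTwist 2).selmerCorank 2 ≤ D.lambda :=
  fun W _ _ hord _ _ hκ hγ D hD ↦
    selmerCorank_add_selmerCorank_quadraticTwist_two_le_lambda h W (Or.inl hord) hκ hγ D hD

end thm19_selmerCorank_layer_le_lambdaInvariant

end Literature.NumberTheory.EllipticCurves.Greenberg1999

end
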